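import Summits.FinalStateConjecture.FinalStateConjecture.Theorems.PhotonSphereChannelsTameCensorshipExactRegionOfLeafMaximal
import Summits.FinalStateConjecture.FinalStateConjecture.Theorems.PhotonSphereChannelsTameCensorshipExactRegionDistance
import Summits.FinalStateConjecture.FinalStateConjecture.Theorems.SwallowTheDatumKerrShieldedSettlesStubCollarEmbedsMGHDAux
import Literature.Geometry.Lorentzian.FinalState
import HarnessLib

/-!
# Crux `TameCensorship` (stmt-FinalStateConjecture-10047), line `crush-the-swallowed-interior`:
# clauses (B1)–(B3) of stub B (`stub_exactKerrBookkeeping`) from two named facts about Kerr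

The registered stub `stub_exactKerrBookkeeping` (skeleton
`Cruxes/TameCensorship/Lines/crush_the_swallowed_interior.lean`, lead c1) is the conjunction of four
clauses (B1)–(B4) about a maximal vacuum development `𝒟` of a Kerr-shielded admissible datum. This
file assembles **(B1) ∧ (B2) ∧ (B3) in the stub's own vocabulary** (hypothesis block verbatim, the
route item `SubdataDevelopmentsEmbed` dropped as unnecessary) from two DISPLAYED hypotheses, the
named facts the clauses really need:

* F_B1 (leaf maximality): the pulled-back datum `D.comap φ` — the exact bent Kerr leaf — has a
  MAXIMAL vacuum Cauchy development `𝒦` with a smooth, isometric, time-orientation preserving map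
  `ε : 𝒦 → Kerr.spacetime M a r₋` (Choquet-Bruhat–Geroch 1969, Thm. 3, applied to Kerr: the maximal
  development of the leaf is its domain of dependence in `{r > r₋}`);
* F_B3 (region II has finite timelike diameter): `d_Kerr(x, y) ≤ C(M, a)` for all `x` with
  `r(x) < r₊` (in region II, `g(∇r, ∇r) = Δ/Σ < 0` and `r` decreases to the future, so the proper
  time of a causal curve from `x` is at most `∫_{r₋}^{r₊} √(Σ/(−Δ)) dr`; O'Neill 1995, Ch. 2–4).

`exactKerrBookkeeping_B123_of_facts`: (B1) is `exactRegion_of_leafMaximal_oriented` (with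
`dφ` injective by `CollarEmbedsMGHD.injective_mfderiv_of_inner_eq` of route SwallowTheDatum, from
the first pull-back identity of the shield, and the slice connected and nonempty,
`Kerr.isConnected_slice_holds`); (B2) is `causalFuture_singleton_subset_of_mem`; (B3) is
`lorentzDist_le_of_exactRegion` fed F_B3 at `χ p`. Clause (B4) (bounded-geometry ball charts) needs
two more facts (Kerr ray optics above the leaf; two-sided bounded geometry of the Kerr exterior) and
the converse embedding (`SubdataDevelopmentsEmbed`); it is not treated here.

References: Choquet-Bruhat–Geroch, CMP 14 (1969), Thm. 3; Sbierski 2016, Def. 2.4–2.5, Thm. 2.6;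
O'Neill 1983, Ch. 14, Def. 14.15, pp. 402–403; O'Neill 1995, Ch. 2–4 (Kerr–Schild Kerr, region II).
-/

noncomputable section

-- The tree namespace `Summit.FinalStateConjecture.FinalStateConjecture.…` (summit = sub-problem)
-- repeats a component by design (D-0022), which the `dupNamespace` linter would flag on every decl.
set_option linter.dupNamespace false

open scoped Manifold ContDiff Topology
open Set Filter Function TopologicalSpace Topology
open Literature.Geometry.Lorentzian

namespace Summit.FinalStateConjecture.FinalStateConjecture.Theorems.PhotonSphereChannels.TameCensorshipCrush

open scoped ENNReal NNReal in
/-- **Clauses (B1)–(B3) of stub B from the two named facts F_B1 (leaf maximality) and F_B3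
(finite timelike diameter of region II)**, in the stub's vocabulary: for a Kerr-shielded admissible
datum (shield block verbatim) and any maximal vacuum development `𝒟`, if `D.comap φ` has a maximal
vacuum development `𝒦` with a smooth isometric time-orientation preserving `ε : 𝒦 → Kerr.spacetime
M a r₋` and the Kerr time separation from points with `r < r₊` is bounded by `C`, then there are
`E' ⊇ E = J⁺(ιX) ∖ J⁺(ι(range φ)ᶜ)` open and `χ : 𝒟 → Kerr.spacetime M a r₋` smooth on `E'` with
`χ^* g_Kerr = g_𝒟` on `E'` (B1), `J⁺(ι(range φ)ᶜ)` is future-closed (B2), and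
`d_𝒟(p, q) ≤ C` for `p, q ∈ E` with `r(χ p) < r₊` (B3). Assembly of
`exactRegion_of_leafMaximal_oriented`, `causalFuture_singleton_subset_of_mem`,
`lorentzDist_le_of_exactRegion`. [cite: ChoquetBruhatGeroch1969CMP, Thm. 3; ONeillSemiRiemannian1983, Ch. 14, Def. 14.15 (p. 409)] -/
theorem exactKerrBookkeeping_B123_of_facts :
    ∀ [Kerr.Facts], ∀ (X : Type) [TopologicalSpace X] [ChartedSpace E3 X] [IsManifold (𝓡 3) ∞ X]
      [T2Space X] [SecondCountableTopology X] [ConnectedSpace X], ∀ D ∈ admissibleVacuumData X, ∀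
      (M a r₁ : ℝ) (hM : 0 ≤ M) (T : ℝ → ℝ) (φ : Kerr.slice a r₁ → X) (ψ : Kerr.slice a r₁ →
      Kerr.region a r₁) (ν : NormalField 𝓘(ℝ, E4) ψ), (|a| < M ∧ Kerr.rMinus M a < r₁ ∧ r₁ <
      Kerr.rPlus M a ∧ T = (fun r : ℝ => Real.smoothTransition (r / (4 * M) - 1) * (((M) /
      Real.sqrt ((M) ^ 2 - (a) ^ 2)) * (Kerr.rPlus M a * Real.log (r - Kerr.rPlus M a) -
      Kerr.rMinus M a * Real.log (r - Kerr.rMinus M a)) - ((M) / Real.sqrt ((M) ^ 2 - (a) ^ 2)) *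
      (Kerr.rPlus M a * Real.log ((4 * M) - Kerr.rPlus M a) - Kerr.rMinus M a * Real.log ((4 * M)
      - Kerr.rMinus M a)))) ∧ IsCompact (Set.range φ)ᶜ ∧ Topology.IsOpenEmbedding φ ∧ ContMDiff
      𝓘(ℝ, E3) (𝓡 3) ((⊤ : ℕ∞) : WithTop ℕ∞) φ ∧ (∀ y : Kerr.slice a r₁, (ψ y : E4) =
      E4.ofTimeSpace (T (Kerr.radius a (E4.ofTimeSpace 0 (y : E3)))) (y : E3)) ∧
      (Kerr.smoothMetric M a r₁).IsSpacelikeImmersion 𝓘(ℝ, E3) ψ ∧ (Kerr.smoothMetric M a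
      r₁).IsFutureUnitNormal 𝓘(ℝ, E3) ((Kerr.timeOrientation M a r₁ hM).ofLE le_top) ψ ν ∧ (∀ y :
      Kerr.slice a r₁, (pullbackBilin φ D.h.inner y : TangentSpace 𝓘(ℝ, E3) y →L[ℝ] TangentSpace
      𝓘(ℝ, E3) y →L[ℝ] ℝ) = pullbackBilin ψ (Kerr.smoothMetric M a r₁).val y) ∧ (∀
      [(Kerr.smoothMetric M a r₁).HasLeviCivita] (y : Kerr.slice a r₁), (pullbackBilin φ D.k y :
      TangentSpace 𝓘(ℝ, E3) y →L[ℝ] TangentSpace 𝓘(ℝ, E3) y →L[ℝ] ℝ).toLinearMap₁₂ =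
      (Kerr.smoothMetric M a r₁).secondFundamentalForm 𝓘(ℝ, E3) ψ ν y)) → ∀ 𝒟 :
      VacuumCauchyDevelopment D, 𝒟.IsMaximal → ∀ [𝒟.metric.HasLeviCivita], (∀ [ConnectedSpace (Kerr.slice a r₁)] (hφ1 : ContMDiff (𝓡
      3) (𝓡 3) (((⊤ : ℕ∞) : WithTop ℕ∞) + 1) φ) (hφ' : ∀ u, Function.Injective (mfderiv (𝓡 3) (𝓡
      3) φ u)), ∃ 𝒦 : VacuumCauchyDevelopment (D.comap φ hφ1 hφ'), 𝒦.IsMaximal ∧ ∃ ε : 𝒦.carrier →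
      (Kerr.spacetime M a (Kerr.rMinus M a) hM).carrier, ContMDiff (𝓡 4) (𝓡 4) ((⊤ : ℕ∞) : WithTop
      ℕ∞) ε ∧ (∀ p, pullbackBilin (I := 𝓡 4) (I' := 𝓡 4) ε (Kerr.spacetime M a (Kerr.rMinus M a)
      hM).metric.val p = 𝒦.metric.val p) ∧ 𝒦.timeOrientation.PreservesTimeOrientation ε
      (Kerr.spacetime M a (Kerr.rMinus M a) hM).timeOrientation) → (∃ C : ℝ≥0, ∀ x y :
      (Kerr.spacetime M a (Kerr.rMinus M a) hM).carrier, Kerr.radius a x.1 < Kerr.rPlus M a →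
      (Kerr.spacetime M a (Kerr.rMinus M a) hM).lorentzDist x y ≤ (C : ℝ≥0∞)) → ∃ (E' : Set
      𝒟.carrier) (χ : 𝒟.carrier → (Kerr.spacetime M a (Kerr.rMinus M a) hM).carrier),
      (𝒟.metric.causalFuture 𝒟.timeOrientation (Set.range 𝒟.embed) \ 𝒟.metric.causalFuture
      𝒟.timeOrientation (𝒟.embed '' (Set.range φ)ᶜ)) ⊆ E' ∧ (IsOpen E' ∧ ContMDiffOn (𝓡 4) (𝓡 4) ∞
      χ E' ∧ ∀ p ∈ E', pullbackBilin χ (Kerr.spacetime M a (Kerr.rMinus M a) hM).metric.val p =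
      𝒟.metric.val p) ∧ (∀ m ∈ 𝒟.metric.causalFuture 𝒟.timeOrientation (𝒟.embed '' (Set.range
      φ)ᶜ), 𝒟.metric.causalFuture 𝒟.timeOrientation {m} ⊆ 𝒟.metric.causalFuture 𝒟.timeOrientation
      (𝒟.embed '' (Set.range φ)ᶜ)) ∧ (∃ C : ℝ≥0, ∀ p ∈ (𝒟.metric.causalFuture 𝒟.timeOrientation
      (Set.range 𝒟.embed) \ 𝒟.metric.causalFuture 𝒟.timeOrientation (𝒟.embed '' (Set.range φ)ᶜ)),
      Kerr.radius a (χ p).1 < Kerr.rPlus M a → ∀ q ∈ (𝒟.metric.causalFuture 𝒟.timeOrientation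
      (Set.range 𝒟.embed) \ 𝒟.metric.causalFuture 𝒟.timeOrientation (𝒟.embed '' (Set.range φ)ᶜ)),
      𝒟.toSpacetime.lorentzDist p q ≤ (C : ℝ≥0∞)) := by
  intro _ X _ _ _ _ _ _ D _ M a r₁ hM T φ ψ ν hsh 𝒟 _ _ hF1 hF3
  obtain ⟨-, -, -, -, hK, hφo, hφs, -, hsp, -, hh, -⟩ := hsh
  -- the slice is connected and nonempty
  haveI : ConnectedSpace (Kerr.slice a r₁) :=
    isConnected_iff_connectedSpace.mp (Kerr.isConnected_slice_holds a r₁)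
  haveI : Nonempty (Kerr.slice a r₁) := (Kerr.isConnected_slice_holds a r₁).1.to_subtype
  -- smoothness degree `∞ + 1 = ∞` and injectivity of `dφ` (first pull-back identity)
  have hφ1 : ContMDiff (𝓡 3) (𝓡 3) (((⊤ : ℕ∞) : WithTop ℕ∞) + 1) φ := hφs
  have hh' : ∀ (y : Kerr.slice a r₁) (v w : E3),
      D.h.inner (φ y) (mfderiv 𝓘(ℝ, E3) (𝓡 3) φ y v) (mfderiv 𝓘(ℝ, E3) (𝓡 3) φ y w) =
        Kerr.bilin M a (ψ y : E4) (mfderiv 𝓘(ℝ, E3) 𝓘(ℝ, E4) ψ y v)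
          (mfderiv 𝓘(ℝ, E3) 𝓘(ℝ, E4) ψ y w) := fun y v w ↦ by
    have h := congrArg (fun B ↦ B v w) (hh y)
    simp only [pullbackBilin_apply, Kerr.smoothMetric_val] at h
    exact h
  have hφ' : ∀ u, Function.Injective (mfderiv (𝓡 3) (𝓡 3) φ u) :=
    _root_.Summit.FinalStateConjecture.FinalStateConjecture.Theorems.SwallowTheDatum.KerrShieldedSettles.CollarEmbedsMGHD.injective_mfderiv_of_inner_eq
      D hsp hh'
  -- F_B1: the maximal leaf development and its chart into `Kerr.spacetime M a r₋`
  obtain ⟨𝒦, h𝒦, ε, hε, hεi, hετ⟩ := hF1 hφ1 hφ'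
  obtain ⟨E', χ, hE, hEo, hχs, hχi, hχτ⟩ :=
    exactRegion_of_leafMaximal_oriented 𝒟 hφ1 hφ' hφo hK 𝒦 h𝒦
      (Kerr.spacetime M a (Kerr.rMinus M a) hM) ε hε hεi hετ
  refine ⟨E', χ, hE, ⟨hEo, hχs, hχi⟩,
    fun m hm ↦ causalFuture_singleton_subset_of_mem 𝒟.toCauchyDevelopment _ hm, ?_⟩
  -- F_B3 at `χ p`
  obtain ⟨C, hC⟩ := hF3
  exact ⟨C, fun p hp hr q hq ↦ lorentzDist_le_of_exactRegion 𝒟.toCauchyDevelopment _ _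
    (Kerr.spacetime M a (Kerr.rMinus M a) hM) hE hEo hχs hχi hχτ hp (fun y ↦ hC (χ p) y hr) hq⟩

end Summit.FinalStateConjecture.FinalStateConjecture.Theorems.PhotonSphereChannels.TameCensorshipCrush

end
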